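import Mathlib.LinearAlgebra.Matrix.GeneralLinearGroup.Card
import Mathlib.LinearAlgebra.Matrix.Rank
import Literature.LinearAlgebra.Subspace.GaussianBinomialCount
import HarnessLib

/-!
# The number of `n × s` matrices of rank `r` over a finite field

Topic `LinearAlgebra/Matrix`; namespace `Literature.LinearAlgebra.Matrix`. Everything here is PROVED
(Mathlib + the tree's Gaussian-binomial subspace count `card_subspaces_fin_eq_qBinomial`
[Cohn2004, Thm. 1]); no named fact.

For a finite field `F` with `q` elements, the `n × s` matrices over `F` of rank `r` number
`R_r^{(n,s)} = [n choose r]_q · ∏_{i<r} (q^s − q^i)`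
(`card_rank_eq_qBinomial_mul_prod`), i.e. — Nazarov 2023, Lemma 1, as printed —
`R_r^{(n,s)} = (∏_{i=0}^{r−1} (q^{n−i} − 1)/(q^{i+1} − 1)) · (q^s − 1)(q^s − q) ⋯ (q^s − q^{r−1})`
(`card_rank_mul_prod_eq`, division-free). The source proves it by induction on `n` (adding a row);
here it is the fibration by the column space: a matrix of rank `r` is a point of the Grassmannian of
`r`-planes `W ≤ F^n` (`[n choose r]_q` of them) together with an `s`-tuple of vectors spanning `W`, and
the `s`-tuples spanning an `r`-dimensional space correspond, after a choice of basis, to the linearly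
independent `r`-tuples in `F^s` (row rank = column rank), counted by Mathlib's `card_linearIndependent`.

## References

* A. A. Nazarov, Vestn. Mosk. Univ. Ser. 15 Vychisl. Mat. Kibern. 2023, no. 4, 41–53, Lemma 1 (p. 43).
  [Nazarov2023FiniteFieldLB]
* H. Cohn, *Projective geometry over 𝔽₁ and the Gaussian binomial coefficients*, Amer. Math. Monthly
  111 (2004) 487–495, Thm. 1. [Cohn2004]
-/

noncomputable section

open Module Submodule Finset Matrix
open scoped Classical

namespace Literature.LinearAlgebra.Matrix

open Literature.Combinatorics.Enumerative Literature.LinearAlgebra.Subspace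

variable {F : Type*} [Field F] {n s : ℕ}

/-- The column space of an `n × s` matrix (a subspace of `F^n`); its dimension is the rank
(`Matrix.rank_eq_finrank_span_cols`). [folklore] -/
def colSpace (A : Matrix (Fin n) (Fin s) F) : Submodule F (Fin n → F) := span F (Set.range A.col)

/-- The rank is the dimension of the column space. [folklore] -/
private theorem rank_eq_finrank_colSpace (A : Matrix (Fin n) (Fin s) F) :
    A.rank = finrank F (colSpace A) := Matrix.rank_eq_finrank_span_cols A

/-- Columns lie in the column space. [folklore] -/
private theorem col_mem_colSpace (A : Matrix (Fin n) (Fin s) F) (j : Fin s) : A.col j ∈ colSpace A :=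
  subset_span ⟨j, rfl⟩

/-- The fibre of the column-space map over `W`: matrices with column space `W` are the `s`-tuples of
vectors of `W` spanning `W`. [folklore] -/
def fibreEquiv (W : Submodule F (Fin n → F)) :
    {A : Matrix (Fin n) (Fin s) F // colSpace A = W} ≃ {f : Fin s → W // span F (Set.range f) = ⊤} where
  toFun A := ⟨fun j => ⟨A.1.col j, by have h := col_mem_colSpace A.1 j; rw [A.2] at h; exact h⟩, by
    apply map_injective_of_injective W.injective_subtype
    rw [Submodule.map_span, Submodule.map_top, Submodule.range_subtype, ← Set.range_comp]
    exact A.2⟩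
  invFun f := ⟨Matrix.of fun i j => (f.1 j : Fin n → F) i, by
    have h : colSpace (Matrix.of fun i j => (f.1 j : Fin n → F) i) =
        Submodule.map W.subtype (span F (Set.range f.1)) := by
      rw [Submodule.map_span, ← Set.range_comp]; rfl
    rw [h, f.2, Submodule.map_top, Submodule.range_subtype]⟩
  left_inv A := by
    apply Subtype.ext
    ext i j
    rfl
  right_inv f := by
    apply Subtype.ext
    funext j
    apply Subtype.ext
    rfl

section Spanning

variable {W : Type*} [AddCommGroup W] [Module F W] {r : ℕ}

/-- After a choice of basis `W ≃ F^r`, an `s`-tuple in `W` is an `r × s` matrix; it spans `W` iff the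
`r` rows are linearly independent (row rank = column rank). [folklore] -/
def spanningEquiv (b : Basis (Fin r) F W) :
    {f : Fin s → W // span F (Set.range f) = ⊤} ≃
      {g : Fin r → (Fin s → F) // LinearIndependent F g} where
  toFun f := ⟨fun i j => b.repr (f.1 j) i, by
    -- the matrix `M i j = b.repr (f j) i`: columns `= b.repr ∘ f` span `F^r`, so the rows are independent
    set M : Matrix (Fin r) (Fin s) F := Matrix.of fun i j => b.repr (f.1 j) i with hM
    have hcols : span F (Set.range M.col) = ⊤ := by
      have e : Set.range M.col = (b.equivFun : W → Fin r → F) '' Set.range f.1 := by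
        rw [← Set.range_comp]; rfl
      rw [e, show (⇑b.equivFun '' Set.range f.1) = ⇑(b.equivFun : W →ₗ[F] (Fin r → F)) '' Set.range f.1
        from rfl, Submodule.span_image, f.2, Submodule.map_top, LinearMap.range_eq_top]
      exact b.equivFun.surjective
    have hrank : M.rank = r := by
      rw [Matrix.rank_eq_finrank_span_cols, hcols, finrank_top, finrank_fin_fun]
    have hrow : LinearIndependent F M.row := by
      rw [linearIndependent_iff_card_eq_finrank_span, Fintype.card_fin, Set.finrank,
        ← Matrix.rank_eq_finrank_span_row, hrank]
    exact hrow⟩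
  invFun g := ⟨fun j => b.equivFun.symm fun i => g.1 i j, by
    set M : Matrix (Fin r) (Fin s) F := Matrix.of fun i j => g.1 i j with hM
    have hrow : LinearIndependent F M.row := g.2
    have hrank : M.rank = r := by
      rw [Matrix.rank_eq_finrank_span_row, ← Set.finrank,
        ← linearIndependent_iff_card_eq_finrank_span.1 hrow, Fintype.card_fin]
    have hcols : span F (Set.range M.col) = ⊤ := by
      apply Submodule.eq_top_of_finrank_eq
      rw [← Matrix.rank_eq_finrank_span_cols, hrank, finrank_fin_fun]
    have e : Set.range (fun j => b.equivFun.symm fun i => g.1 i j) =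
        (b.equivFun.symm : (Fin r → F) → W) '' Set.range M.col := by
      rw [← Set.range_comp]; rfl
    rw [e, show (⇑b.equivFun.symm '' Set.range M.col) =
        ⇑(b.equivFun.symm : (Fin r → F) →ₗ[F] W) '' Set.range M.col from rfl, Submodule.span_image, hcols,
      Submodule.map_top, LinearMap.range_eq_top]
    exact b.equivFun.symm.surjective⟩
  left_inv f := by
    apply Subtype.ext
    funext j
    change b.equivFun.symm (fun i => b.repr (f.1 j) i) = f.1 j
    exact b.equivFun.symm_apply_apply (f.1 j)
  right_inv g := by
    apply Subtype.ext
    funext i j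
    change b.repr (b.equivFun.symm fun i => g.1 i j) i = g.1 i j
    rw [← b.equivFun_apply, LinearEquiv.apply_symm_apply]

end Spanning

variable [Fintype F]

/-- The number of `s`-tuples spanning an `r`-dimensional space over a field with `q` elements is
`∏_{i<r} (q^s − q^i)`. [folklore] -/
private theorem card_spanning {W : Type*} [AddCommGroup W] [Module F W] [FiniteDimensional F W] {r : ℕ}
    (hW : finrank F W = r) (hr : r ≤ s) :
    Nat.card {f : Fin s → W // span F (Set.range f) = ⊤} =
      ∏ i ∈ range r, (Fintype.card F ^ s - Fintype.card F ^ i) := by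
  rw [Nat.card_congr (spanningEquiv (s := s) (finBasisOfFinrankEq F W hW)),
    card_linearIndependent (K := F) (V := Fin s → F) (by rw [finrank_fin_fun]; exact hr),
    finrank_fin_fun, Fin.prod_univ_eq_prod_range (fun i => Fintype.card F ^ s - Fintype.card F ^ i) r]

/-- **The number of `n × s` matrices of rank `r` over a finite field with `q` elements is
`[n choose r]_q · ∏_{i<r} (q^s − q^i)`** (for `r > min(n, s)` both sides vanish).
[cite: Nazarov2023FiniteFieldLB, Lemma 1] -/
theorem card_rank_eq_qBinomial_mul_prod (n s r : ℕ) :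
    (Nat.card {A : Matrix (Fin n) (Fin s) F // A.rank = r} : ℤ) =
      qBinomial (Fintype.card F : ℤ) n r * ∏ i ∈ range r, ((Fintype.card F : ℤ) ^ s - (Fintype.card F : ℤ) ^ i) := by
  rcases le_or_gt r s with hr | hr
  · -- fibration by the column space; every fibre is `{g : Fin r → F^s // independent}`
    have e : {A : Matrix (Fin n) (Fin s) F // A.rank = r} ≃
        Σ _ : {W : Submodule F (Fin n → F) // finrank F W = r},
          {g : Fin r → (Fin s → F) // LinearIndependent F g} :=
      { toFun := fun A => ⟨⟨colSpace A.1, by rw [← rank_eq_finrank_colSpace]; exact A.2⟩, ⟨A.1, rfl⟩⟩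
        invFun := fun p => ⟨p.2.1, by rw [rank_eq_finrank_colSpace, p.2.2]; exact p.1.2⟩
        left_inv := fun A => rfl
        right_inv := fun p => by
          cases p with | mk W' A' => ?_
          cases W' with | mk W hW => ?_
          cases A' with | mk A hA => ?_
          change colSpace A = W at hA
          subst hA
          rfl : {A : Matrix (Fin n) (Fin s) F // A.rank = r} ≃
          Σ W : {W : Submodule F (Fin n → F) // finrank F W = r},
            {A : Matrix (Fin n) (Fin s) F // colSpace A = W.1} }.trans
        (Equiv.sigmaCongrRight fun W =>
          (fibreEquiv W.1).trans (spanningEquiv (s := s) (finBasisOfFinrankEq F W.1 W.2)))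
    rw [Nat.card_congr (e.trans (Equiv.sigmaEquivProd _ _)), Nat.card_prod, Nat.cast_mul,
      card_subspaces_fin_eq_qBinomial, Nat.card_eq_fintype_card (α := F),
      card_linearIndependent (K := F) (V := Fin s → F) (by rw [finrank_fin_fun]; exact hr),
      finrank_fin_fun, Fin.prod_univ_eq_prod_range (fun i => Fintype.card F ^ s - Fintype.card F ^ i) r,
      Nat.cast_prod]
    refine congrArg _ (Finset.prod_congr rfl fun i hi => ?_)
    have hi' : i < r := Finset.mem_range.1 hi
    rw [Nat.cast_sub (Nat.pow_le_pow_right Fintype.card_pos (by omega))]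
    push_cast
    ring
  · -- `r > s`: no such matrix, and the factor `i = s` of the product vanishes
    have h0 : Nat.card {A : Matrix (Fin n) (Fin s) F // A.rank = r} = 0 := by
      rw [Nat.card_eq_zero]
      left
      refine ⟨fun A => ?_⟩
      have h1 := Matrix.rank_le_width A.1
      have h2 := A.2
      have h3 : Fintype.card (Fin s) = s := Fintype.card_fin s
      omega
    rw [h0, Nat.cast_zero, Finset.prod_eq_zero (Finset.mem_range.2 hr) (by ring), mul_zero]

/-- **Nazarov 2023, Lemma 1, as printed** (division-free): for `r ≤ n`,
`R_r^{(n,s)} · ∏_{i<r} (q^{i+1} − 1) = ∏_{i<r} (q^{n−i} − 1) · ∏_{i<r} (q^s − q^i)`, i.e.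
`R_r^{(n,s)} = (∏_{i=0}^{r−1} (q^{n−i} − 1)/(q^{i+1} − 1)) (q^s − 1)(q^s − q)⋯(q^s − q^{r−1})`.
[cite: Nazarov2023FiniteFieldLB, Lemma 1] -/
theorem card_rank_mul_prod_eq {r : ℕ} (hr : r ≤ n) (s : ℕ) :
    (Nat.card {A : Matrix (Fin n) (Fin s) F // A.rank = r} : ℤ) *
        ∏ i ∈ range r, ((Fintype.card F : ℤ) ^ (i + 1) - 1) =
      (∏ i ∈ range r, ((Fintype.card F : ℤ) ^ (n - i) - 1)) *
        ∏ i ∈ range r, ((Fintype.card F : ℤ) ^ s - (Fintype.card F : ℤ) ^ i) := by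
  rw [card_rank_eq_qBinomial_mul_prod]
  have key := qBinomial_mul_prod_eq_prod (Fintype.card F : ℤ) hr
  have h1 : ∏ i ∈ range r, ((Fintype.card F : ℤ) ^ (i + 1) - 1) =
      (-1) ^ r * ∏ i ∈ range r, (1 - (Fintype.card F : ℤ) ^ (i + 1)) := by
    rw [← Finset.card_range r, ← Finset.prod_const, Finset.card_range, ← Finset.prod_mul_distrib]
    exact Finset.prod_congr rfl fun i _ => by ring
  have h2 : ∏ i ∈ range r, ((Fintype.card F : ℤ) ^ (n - i) - 1) =
      (-1) ^ r * ∏ i ∈ range r, (1 - (Fintype.card F : ℤ) ^ (n - i)) := by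
    rw [← Finset.card_range r, ← Finset.prod_const, Finset.card_range, ← Finset.prod_mul_distrib]
    exact Finset.prod_congr rfl fun i _ => by ring
  rw [h1, h2, ← key]
  ring

/-- Sanity check `r = 1`: `R_1^{(n,s)} (q − 1) = (q^n − 1)(q^s − 1)`
(the source's base case `R_1 = (q^s − 1)(q^{n−1} + ⋯ + 1)`). [cite: Nazarov2023FiniteFieldLB, Lemma 1 (proof, base case)] -/
theorem card_rank_one_mul (hn : 1 ≤ n) (s : ℕ) :
    (Nat.card {A : Matrix (Fin n) (Fin s) F // A.rank = 1} : ℤ) * ((Fintype.card F : ℤ) - 1) =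
      ((Fintype.card F : ℤ) ^ n - 1) * ((Fintype.card F : ℤ) ^ s - 1) := by
  have h := card_rank_mul_prod_eq (F := F) hn s
  rw [Finset.prod_range_one, Finset.prod_range_one, Finset.prod_range_one, zero_add, pow_one,
    Nat.sub_zero, pow_zero] at h
  exact h

end Literature.LinearAlgebra.Matrix

end
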